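import Literature.AnabelianGeometry.AbsoluteAnabelian.AbsTopIII.ReconstructionCor110iaNaturalProofs
import Literature.AnabelianGeometry.AbsoluteAnabelian.AbsTopIII.ReconstructionCor110NatResidueRestriction
import Literature.AnabelianGeometry.AbsoluteAnabelian.GaloisCyclotomeRestrictionCompatHolds
import HarnessLib

/-!
# [AbsTopIII] Cor. 1.10 (i)(a) with Rmk. 1.10.1 (iii) — `AbsTopIII.cor_1_10_i_a_resNatural_holds`

Mochizuki, *Topics in Absolute Anabelian Geometry III*, Cor. 1.10 (i)(a) p. 42 and Rmk. 1.10.1 p. 44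
[MochizukiAbsTopIII2015] (manuscript `paper:url-5493eb38cbb7`, read on the page, cell render
`AbsTopIII-kurims-url-5493eb38cbb7`).  Cor. 1.10 (i) p. 42 l. 24–25 (closing (a)–(b)), verbatim: «Here, the
asserted "functoriality" is with respect to arbitrary injective open homomorphisms of profinite groups [cf.
also Remark 1.10.1, (iii), below].»  Rmk. 1.10.1 (iii) p. 44 l. 48–53, THE CLAUSE THIS FILE FORMALISES,
verbatim: «(iii) In a similar vein, note that the isomorphism H²(G_k, μ_Ẑ(G_k)) ⥲ Ẑ of Corollary 1.10, (a), is
functorial in the sense that it is compatible with the result of dividing the usual functorially induced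
morphism by a factor given by the index of the open subgroups of G_k under consideration.»  For orientation
only (NOT the clause formalised here — it concerns the cyclotomes μ_Ẑ(Π_X) of Thm. 1.9 / Cor. 1.10 under
passage to open subgroups of Π_X), Rmk. 1.10.1 (i) p. 44 l. 38–42 reads: «(i) In general, the functoriality
of Theorem 1.9, Corollary 1.10, when applied to the operation of passing to open subgroups of Π_X, is to be
understood in the sense of a
"compatibility", relative to dividing the usual functorially induced morphism on "μ_Ẑ(Π_X)'s" by a factor
given by the index of the subgroups of Δ_X that arise from the open subgroups of Π_X under consideration
[cf., e.g., [Mzk19], Remark 1].»  (Doc v2, abc-iut-L4-d3 gen 11: closes referee finding ref-k K32-n5 — v1's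
header spliced clause (i)'s tokens into a quote attributed to (iii); the formalised statement was and is
(iii)'s: subject H²(G_k, μ_Ẑ(G_k)) ≅ Ẑ, index over open subgroups of G_k.  Declarations byte-identical to v1.)

WHY THIS FILE (abc-iut layer L4, row «COR110ia-NAT-OPEN», L4-lead RULING #7s; abc-iut-L4-d3).  PROOF-ONLY
(no definition, no named fact).  abc-iut-L4-d1 typed `AbsTopIII.Cor_1_10_i_a_resNatural`
(`ReconstructionCor110iaNatural.lean`): ONE family `r_k : H²(G_k, μ_Ẑ(G_k)) ≃+ Ẑ` with (1) `r_k` IS the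
residue map levelwise, (2) invariance under every isomorphism of topological groups `G_{k₁} ≃ₜ* G_{k₂}`, and
(3) the index formula `r_{k′} (Res x) = [k′ : k] • r_k x` along every finite extension `k′/k`; and proved
(1)+(2) for THE family `Cor110iaNat.residueIso` (`ReconstructionCor110iaNaturalProofs.lean`).  This file
supplies (3) for that family and the closer:

* `Cor110iaNat.residueIso_galCyclotomeRes_of_compatible` — clause (3) for `residueIso` GIVEN the
  restriction-compatibility of THE characterised cyclotome identifications
  (`D_{k′}.equiv = inducedCyclotomeEquiv k k′ D_k.equiv` pointwise), by abc-iut-L4-d3's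
  `Cor110Nat.residue_galCyclotomeRes_of_compatible` (`ReconstructionCor110NatResidueRestriction.lean`:
  junction with abc-iut-L4-t17's `cycProj`, abc-iut-w5-d201's `cohomologyMap_cycProj_galCyclotomeRes`, and
  `Prop121vii.invLevel_resMu` = Serre XIII §3 Prop. 7 `inv_{k′} ∘ Res = [k′ : k] · inv_k`);
* `AbsTopIII.cor_1_10_i_a_resNatural_of_compatible` — the typed Prop from that compatibility, quantified
  over all finite extensions of MLFs; `Cor110Nat.compatible_of_coe_symm_eq` converts abc-iut-L4-t11's
  values-in-`k̄′` shape of the compatibility (`ReconstructionCor110OpenFunctoriality.lean`, binder `hcompat`)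
  into the pointwise shape used here.

The remaining input — that THE characterised identifications ARE restriction-compatible ([AbsAnab]
Prop. 1.2.1 (vi) «by considering the Verlagerung»; abc-iut-L4-t11, row «COR110ib-OPEN» file F) — is the
one hypothesis of `cor_1_10_i_a_resNatural_of_compatible`; the unconditional
`AbsTopIII.cor_1_10_i_a_resNatural_holds` is that theorem applied to it.

HONEST FRAMING: classical local class field theory (the invariant map under restriction) read through the
group-theoretic cyclotome; nothing here bears on [IUTchIII] Cor. 3.12.
-/

noncomputable section

open CategoryTheory Function
open Field IsNonarchimedeanLocalField ValuativeRel
open ProfiniteGrp ProfiniteGrp.ProfiniteCompletion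

namespace Literature.AnabelianGeometry.AbsoluteAnabelian

open _root_.TopRep _root_.ContRepresentation _root_.ContinuousCohomology
open Literature.NumberTheory.GaloisRepresentations
open Literature.NumberTheory.GaloisRepresentations.DiscreteGaloisModule
open Literature.AnabelianGeometry.EtaleTheta Literature.AnabelianGeometry.EtaleTheta.ZHatLevel

namespace Cor110Nat

section Compat

variable {k k' : Type} [Field k] [CharZero k] [Field k'] [CharZero k'] [Algebra k k'] [FiniteDimensional k k']
  (φ : muQZ (absoluteGaloisGroup k) ≃+ Additive (CommGroup.torsion (AlgebraicClosure k)ˣ))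
  (φ' : muQZ (absoluteGaloisGroup k') ≃+ Additive (CommGroup.torsion (AlgebraicClosure k')ˣ))

/-- **The two shapes of restriction-compatibility agree**: abc-iut-L4-t11's `hcompat`
(`φ′ ∘ μ_{ℚ/ℤ}(res)⁻¹ = ι ∘ φ` on values in `k̄′`, `ReconstructionCor110OpenFunctoriality`) gives the pointwise
identity `φ′ = inducedCyclotomeEquiv k k′ φ` used by `residue_galCyclotomeRes_of_compatible` (the torsion of
`k̄′ˣ` embeds in `k̄′`). [cite: MochizukiAbsTopIII2015, Remark 1.10.1 p.44] -/
theorem compatible_of_coe_symm_eq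
    (hcompat : ∀ z : muQZ (absoluteGaloisGroup k),
      (((Additive.toMul (φ' ((muQZ.mapOfOpenEmbedding (absGaloisRestrict k k')
          (absGaloisRestrict_injective k k') (isOpen_range_absGaloisRestrict k k')).symm z)) :
          CommGroup.torsion (AlgebraicClosure k')ˣ) : (AlgebraicClosure k')ˣ) : AlgebraicClosure k') =
        absClosureEmbedding k k' ((((Additive.toMul (φ z)) : CommGroup.torsion (AlgebraicClosure k)ˣ) :
          (AlgebraicClosure k)ˣ) : AlgebraicClosure k))
    (x : muQZ (absoluteGaloisGroup k')) : φ' x = inducedCyclotomeEquiv k k' φ x := by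
  have h := hcompat (muQZ.mapOfOpenEmbedding (absGaloisRestrict k k') (absGaloisRestrict_injective k k')
    (isOpen_range_absGaloisRestrict k k') x)
  rw [AddEquiv.symm_apply_apply] at h
  apply Additive.toMul.injective
  apply Subtype.ext
  apply Units.ext
  rw [h, inducedCyclotomeEquiv_apply, coe_toMul_torsionUnitsTransport]

end Compat

end Cor110Nat

namespace Cor110iaNat

section Index

variable (k k' : Type) [Field k] [ValuativeRel k] [TopologicalSpace k] [IsNonarchimedeanLocalField k]
  [CharZero k] [Field k'] [ValuativeRel k'] [TopologicalSpace k'] [IsNonarchimedeanLocalField k']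
  [CharZero k'] [Algebra k k'] [FiniteDimensional k k']

/-- **Clause (3) for THE family `residueIso`, given restriction-compatibility of THE data**: if the
characterised identification of `k′` takes the values of the one induced from `k`
(`D_{k′}.equiv x = inducedCyclotomeEquiv k k′ D_k.equiv x`), then
`r_{k′} (Res x) = [k′ : k] • r_k x` for every `x ∈ H²(G_k, μ_Ẑ(G_k))`.
[cite: MochizukiAbsTopIII2015, Remark 1.10.1 p.44] -/
theorem residueIso_galCyclotomeRes_of_compatible
    (hres : ∀ x : muQZ (absoluteGaloisGroup k'), (datum k').equiv x =
      inducedCyclotomeEquiv k k' (datum k).equiv x)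
    (x : galCyclotomeH2 (absoluteGaloisGroup k)) :
    residueIso k' ((galCyclotomeRes k k' 2).hom x) = (Module.finrank k k') • residueIso k x := by
  rw [residueIso_apply, residueIso_apply]
  exact Cor110Nat.residue_galCyclotomeRes_of_compatible (datum k).equiv (datum k).equiv_smul
    (datum k').equiv (datum k').equiv_smul hres x

end Index

end Cor110iaNat

namespace AbsTopIII

/-- **[AbsTopIII] Cor. 1.10 (i)(a) + Rmk. 1.10.1 (iii) from restriction-compatibility of THE data.**
If for every finite extension `k′/k` of MLFs the characterised cyclotome identification of `k′` is the one
induced from `k`, then `Cor_1_10_i_a_resNatural` holds, witnessed by THE family `Cor110iaNat.residueIso`: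
(1) `level_residueIso`, (2) `residueIso_natural` (abc-iut-L4-d1), (3) `residueIso_galCyclotomeRes_of_compatible`.
[cite: MochizukiAbsTopIII2015, Remark 1.10.1 p.44] -/
theorem cor_1_10_i_a_resNatural_of_compatible
    (hres : ∀ (k : Type) [Field k] [ValuativeRel k] [TopologicalSpace k] [IsNonarchimedeanLocalField k]
      [CharZero k] (k' : Type) [Field k'] [ValuativeRel k'] [TopologicalSpace k']
      [IsNonarchimedeanLocalField k'] [CharZero k'] [Algebra k k'] [FiniteDimensional k k']
      (x : muQZ (absoluteGaloisGroup k')),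
      (Cor110iaNat.datum k').equiv x = inducedCyclotomeEquiv k k' (Cor110iaNat.datum k).equiv x) :
    Cor_1_10_i_a_resNatural :=
  ⟨fun k _ _ _ _ _ => Cor110iaNat.residueIso k,
    fun k _ _ _ _ _ => ⟨(Cor110iaNat.datum k).equiv, (Cor110iaNat.datum k).equiv_smul,
      fun x n => Cor110iaNat.level_residueIso k x n⟩,
    fun _ _ _ _ _ _ _ _ _ _ _ _ α x => Cor110iaNat.residueIso_natural α x,
    fun k _ _ _ _ _ k' _ _ _ _ _ _ _ x =>
      Cor110iaNat.residueIso_galCyclotomeRes_of_compatible k k' (hres k k') x⟩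

/-- **[AbsTopIII] Cor. 1.10 (i)(a) + Rmk. 1.10.1 (iii), unconditional**: THE family `Cor110iaNat.residueIso`
satisfies (1) the residue levelwise, (2) naturality in isomorphisms of absolute Galois groups, (3) the index
formula `[k′ : k] •` along every finite extension `k′/k` of MLFs — (3) by the restriction-compatibility of THE
characterised identifications `μ_{ℚ/ℤ}(G_k) ≅ μ(k̄)` ([AbsAnab] Prop. 1.2.1 (vi); abc-iut-L4-t11, file F:
`Cor110Open.levelChar_equiv_eq_inducedCyclotomeEquiv`). [cite: MochizukiAbsTopIII2015, Remark 1.10.1 p.44] -/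
theorem cor_1_10_i_a_resNatural_holds : Cor_1_10_i_a_resNatural :=
  cor_1_10_i_a_resNatural_of_compatible fun k _ _ _ _ _ k' _ _ _ _ _ _ _ x =>
    Cor110Open.levelChar_equiv_eq_inducedCyclotomeEquiv k k' x

end AbsTopIII

end Literature.AnabelianGeometry.AbsoluteAnabelian
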